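import Mathlib
import Literature.Analysis.Convex.RestartedPDHG
import HarnessLib

/-!
# What the normalized duality gap certifies for a conic linear program
# (Xiong–Freund, *The role of level-set geometry on the performance of PDHG for conic linear
# optimization*, arXiv:2406.01942 (2024), §2.3 Lemma 2.1, §2.4 Lemma 2.3 and Corollary 2.5)

Topic `Literature/Analysis/Convex` (companion of `RestartedPDHG.lean`: the `M`-seminorm `normM`, the
gap function `gap`, the normalized duality gap `rho`, the averaged PDHG map `avgPDHG` with its Property 3
`rho_avgPDHG_le` / `normM_avgPDHG_sub_le_infDistM`, the solution set `saddleSet`). Namespace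
`Literature.Analysis.Convex.ConicNormalizedDualityGap`. Everything is PROVED; no named facts.

THE PRINTED STATEMENT [XiongFreund2024, Lemma 2.1, p. 9, read at the page]. For the conic program
`min cᵀx : Ax = b, x ∈ K_p` with saddle form `min_{x ∈ K_p} max_{y ∈ ℝ^m} cᵀx + bᵀy − xᵀAᵀy`, dual
slack `s = c − Aᵀy ∈ K_d = K_p^*`, the normalized duality gap
`ρ(r; z) = r⁻¹ sup {L(x, ŷ) − L(x̂, y) : x̂ ∈ K_p, ‖ẑ − z‖_M ≤ r}` [Def. 2.1] satisfies, for every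
`z̄ = (x̄, ȳ)` with `x̄ ∈ K_p`, `r > 0`, `s̄ = c − Aᵀȳ`, `w̄ = (x̄, s̄)`:
(1.) `Dist(w̄, V) ≤ ρ(r; z̄)/(√σ λ_min)`; (2.) `Dist(w̄, K) ≤ ρ(r; z̄)/√τ`;
(3.) `Gap(w̄) ≤ max{r, ‖z̄‖_M} ρ(r; z̄)`. [Lemma 2.3]: if `‖z_b − z*‖_M ≤ ‖z_a − z*‖_M` and
`‖z_c − z*‖_M ≤ ‖z_a − z*‖_M` for all `z* ∈ Z*` then `max{‖z_b − z_c‖_M, ‖z_b‖_M} ≤ 2 Dist_M(z_a, Z*) + ‖z_a‖_M`.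
[Corollary 2.5]: along PDHG, `w̄ᵏ = (x̄ᵏ, c − Aᵀȳᵏ)` has `Dist(w̄ᵏ, V) ≤ 8 Dist_M(z⁰, Z*)/(√σλ_min k)`,
`Dist(w̄ᵏ, K) ≤ 8 Dist_M(z⁰, Z*)/(√τ k)`, `Gap(w̄ᵏ) ≤ (16 Dist_M(z⁰, Z*) + 8‖z⁰‖_M) Dist_M(z⁰, Z*)/k`.

WHAT IS TYPED, in the vocabulary of `RestartedPDHG.lean` (saddle `L(x, y) = ⟨c, x⟩ + ⟨Kx, y⟩ − ⟨b, y⟩`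
on `C × univ`, i.e. the paper's `A = −K`, `b ↦ −b`; `C : ProperCone ℝ X` a closed convex cone; dual
slack `s̄ = c + K*ȳ`, dual cone `C^* = ProperCone.innerDual C`; primal constraint `Kx = b`; duality
gap `⟨c, x̄⟩ + ⟨b, ȳ⟩`):

* `gap_le_mul_rho` — `G(z; ζ) ≤ r ρ_r(z)` on the feasible `M`-ball (the definition, given that the gap
  set is bounded above: automatic for `τσ‖K‖² < 1`, `RestartedPDHG.bddAbove_gap_ball`);
  `normM_inl`/`normM_inr` — `‖(u, 0)‖_M = ‖u‖/√τ`, `‖(0, v)‖_M = ‖v‖/√σ`.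
* **Lemma 2.1 (1.)** in residual form: `norm_primal_residual_le` — `‖Kx̄ − b‖ ≤ ρ_r(z̄)/√σ` (the
  printed `Dist(x̄, V_p) ≤ ‖Ax̄ − b‖/λ_min` is the finite-dimensional linear-algebra step that follows
  and is not repeated here).
* **Lemma 2.1 (2.)**: `neg_inner_dualSlack_le` — the support form `−⟨c + K*ȳ, u⟩ ≤ ρ_r(z̄)/√τ` for all
  `u ∈ C`, `‖u‖ ≤ 1` — and **`infDist_dualSlack_innerDual_le`** — `Dist(c + K*ȳ, C^*) ≤ ρ_r(z̄)/√τ`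
  (the printed form; Moreau's decomposition is replaced by the nearest point of `C^*` plus the bipolar
  theorem `ProperCone.innerDual_innerDual`).
* **Lemma 2.1 (3.)**: `primalDual_gap_le` — `⟨c, x̄⟩ + ⟨b, ȳ⟩ ≤ max{r, ‖z̄‖_M} ρ_r(z̄)`.
* The solution set for `D = univ` and a cone: `kkt_of_mem_saddleSet` (`Kx* = b`, `c + K*y* ∈ C^*`,
  `⟨c, x*⟩ + ⟨b, y*⟩ = 0`) = the remark after Lemma 2.1 ("when the normalized duality gap is `0`, then
  `w̄ ∈ W*`" read backwards: `W* = F ∩ {Gap = 0}`).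
* **Lemma 2.3**: `normM_le_two_infDistM_add`.
* **Corollary 2.5** for the averaged PDHG output `z̄ᵏ = avgPDHG k z⁰` (this file's Property-3 constants
  `2·2 = 4` for the printed `8`): `norm_primal_residual_avgPDHG_le` (`‖Kx̄ᵏ − b‖ ≤ 4 dist_M(z⁰,Z*)/(√σ k)`),
  `infDist_dualSlack_avgPDHG_le` (`Dist(c + K*ȳᵏ, C^*) ≤ 4 dist_M(z⁰,Z*)/(√τ k)`),
  `primalDual_gap_avgPDHG_le` (`⟨c, x̄ᵏ⟩ + ⟨b, ȳᵏ⟩ ≤ (2 dist_M(z⁰,Z*) + ‖z⁰‖_M) · 4 dist_M(z⁰,Z*)/k`).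

Deviations from print, all inessential: general `τ, σ` with `τσ‖K‖² < 1` where the supremum in `ρ`
must be finite (the boundary case `τσ‖K‖² = 1` of (2.6) is covered by the `BddAbove` variants);
constants `4` for `8` (Property 3 of `RestartedPDHG.lean`); the `λ_min` step of (1.) left to linear
algebra. Deliberately NOT here: Lemma 2.2 (= `RestartedPDHG.normM_pdhgIter_sub_le`), Lemma 2.4
(= `rho_avgPDHG_le` + `normM_avgPDHG_sub_le_infDistM`), §3 (see `PrimalDualRestartSharpness.lean`,
`SublevelSetGeometry.lean`).
-/

noncomputable section

namespace Literature.Analysis.Convex.ConicNormalizedDualityGap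

open scoped RealInnerProductSpace
open Metric Set
open Literature.Analysis.Convex.PrimalDualHybridGradient (conicL shiftOp metricM inner_metricM_self
  isMonotone_shiftOp)
open Literature.Analysis.Convex.RestartedPDHG
open Literature.Analysis.Convex.MonotoneOperator (IsResolventMap IsMonotone)
open Literature.Analysis.Convex.DouglasRachford (normalCone isMonotone_normalCone)

variable {X Y : Type*} [NormedAddCommGroup X] [InnerProductSpace ℝ X] [CompleteSpace X]
  [NormedAddCommGroup Y] [InnerProductSpace ℝ Y] [CompleteSpace Y]

/-! ### The `M`-seminorm of pure primal / pure dual displacements -/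

omit [CompleteSpace X] [CompleteSpace Y] in
/-- `‖(u, 0)‖²_M = ‖u‖²/τ`. [cite: XiongFreund2024, §2.2 display (2.5)] -/
theorem qM_inl [CompleteSpace X] [CompleteSpace Y] (K : X →L[ℝ] Y) (τ σ : ℝ) (u : X) :
    qM K τ σ (u, 0) = τ⁻¹ * ‖u‖ ^ 2 := by
  rw [qM_eq, inner_metricM_self]
  simp

omit [CompleteSpace X] [CompleteSpace Y] in
/-- `‖(0, v)‖²_M = ‖v‖²/σ`. [cite: XiongFreund2024, §2.2 display (2.5)] -/
theorem qM_inr [CompleteSpace X] [CompleteSpace Y] (K : X →L[ℝ] Y) (τ σ : ℝ) (v : Y) :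
    qM K τ σ (0, v) = σ⁻¹ * ‖v‖ ^ 2 := by
  rw [qM_eq, inner_metricM_self]
  simp

omit [CompleteSpace X] [CompleteSpace Y] in
/-- `‖(u, 0)‖_M = ‖u‖/√τ` (`τ > 0`). [cite: XiongFreund2024, Lemma 2.1 (proof of (2.): ‖(x − x̄, 0)‖_M = √τ r · τ⁻¹ᐟ²)] -/
theorem normM_inl [CompleteSpace X] [CompleteSpace Y] (K : X →L[ℝ] Y) {τ : ℝ} (hτ : 0 < τ) (σ : ℝ)
    (u : X) : normM K τ σ (u, 0) = ‖u‖ / Real.sqrt τ := by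
  unfold normM
  rw [qM_inl, Real.sqrt_mul (inv_nonneg.mpr hτ.le), Real.sqrt_sq (norm_nonneg _), Real.sqrt_inv,
    div_eq_inv_mul]

omit [CompleteSpace X] [CompleteSpace Y] in
/-- `‖(0, v)‖_M = ‖v‖/√σ` (`σ > 0`). [cite: XiongFreund2024, Lemma 2.1 (proof of (1.): ‖(0, y − ȳ)‖_M = √σ r · σ⁻¹ᐟ²)] -/
theorem normM_inr [CompleteSpace X] [CompleteSpace Y] (K : X →L[ℝ] Y) (τ : ℝ) {σ : ℝ} (hσ : 0 < σ)
    (v : Y) : normM K τ σ (0, v) = ‖v‖ / Real.sqrt σ := by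
  unfold normM
  rw [qM_inr, Real.sqrt_mul (inv_nonneg.mpr hσ.le), Real.sqrt_sq (norm_nonneg _), Real.sqrt_inv,
    div_eq_inv_mul]

/-! ### Reading the normalized duality gap: `G(z; ζ) ≤ r ρ_r(z)` on the ball -/

/-- **The defining inequality of `ρ_r`**: for `ζ ∈ C × D` with `‖ζ − z‖_M ≤ r` (`r > 0`),
`G(z; ζ) ≤ r · ρ_r(z)`, provided the gap set over the ball is bounded above (always the case for
`τσ‖K‖² < 1`, `RestartedPDHG.bddAbove_gap_ball`). [cite: XiongFreund2024, Lemma 2.1 (proof, display (2.9))] -/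
theorem gap_le_mul_rho (K : X →L[ℝ] Y) (C : Set X) (D : Set Y) (c : X) (b : Y) (τ σ : ℝ)
    {z ζ : X × Y} {r : ℝ} (hr : 0 < r)
    (hbdd : BddAbove ((fun ζ => gap K c b z ζ) ''
      {ζ : X × Y | ζ.1 ∈ C ∧ ζ.2 ∈ D ∧ normM K τ σ (ζ - z) ≤ r}))
    (hζ1 : ζ.1 ∈ C) (hζ2 : ζ.2 ∈ D) (hζ : normM K τ σ (ζ - z) ≤ r) :
    gap K c b z ζ ≤ r * rho K C D c b τ σ r z := by
  have h := le_csSup hbdd ⟨ζ, ⟨hζ1, hζ2, hζ⟩, rfl⟩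
  unfold rho
  rw [← mul_assoc, mul_inv_cancel₀ hr.ne', one_mul]
  exact h

/-- `ρ_r(z) ≥ 0` at a feasible `z` when the gap set is bounded above (`G(z; z) = 0` is in the set).
[cite: XiongFreund2024, Definition 2.1] -/
theorem rho_nonneg_of_bddAbove (K : X →L[ℝ] Y) (C : Set X) (D : Set Y) (c : X) (b : Y) (τ σ : ℝ)
    {z : X × Y} {r : ℝ} (hr : 0 < r)
    (hbdd : BddAbove ((fun ζ => gap K c b z ζ) ''
      {ζ : X × Y | ζ.1 ∈ C ∧ ζ.2 ∈ D ∧ normM K τ σ (ζ - z) ≤ r}))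
    (hz1 : z.1 ∈ C) (hz2 : z.2 ∈ D) : 0 ≤ rho K C D c b τ σ r z := by
  have h := gap_le_mul_rho K C D c b τ σ hr hbdd hz1 hz2 (by rw [sub_self, normM_zero]; exact hr.le)
  rw [gap_self] at h
  nlinarith

/-! ### Lemma 2.1 (1.): the primal residual -/

/-- **[XiongFreund2024, Lemma 2.1 (1.)], residual form**: for `x̄ ∈ C` (`D = univ`, `r > 0`),
`‖Kx̄ − b‖ ≤ ρ_r(z̄)/√σ` — test point `ζ = (x̄, ȳ + (√σ r/‖u‖) u)`, `u = Kx̄ − b`, of `M`-distance `r`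
and gap `√σ r ‖u‖`. (The printed (1.) continues with `Dist(x̄, {Ax = b}) ≤ ‖Ax̄ − b‖/λ_min`.)
[cite: XiongFreund2024, Lemma 2.1 (1.)] -/
theorem norm_primal_residual_le (K : X →L[ℝ] Y) (C : Set X) (c : X) (b : Y) {τ σ : ℝ}
    (hσ : 0 < σ) {z : X × Y} (hz1 : z.1 ∈ C) {r : ℝ} (hr : 0 < r)
    (hbdd : BddAbove ((fun ζ => gap K c b z ζ) ''
      {ζ : X × Y | ζ.1 ∈ C ∧ ζ.2 ∈ (univ : Set Y) ∧ normM K τ σ (ζ - z) ≤ r})) :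
    ‖K z.1 - b‖ ≤ rho K C univ c b τ σ r z / Real.sqrt σ := by
  set u := K z.1 - b with hu
  have hsσ : 0 < Real.sqrt σ := Real.sqrt_pos.mpr hσ
  have hρ0 : 0 ≤ rho K C univ c b τ σ r z :=
    rho_nonneg_of_bddAbove K C univ c b τ σ hr hbdd hz1 (mem_univ _)
  rcases eq_or_ne u 0 with hu0 | hune
  · rw [hu0, norm_zero]; positivity
  have hun : 0 < ‖u‖ := norm_pos_iff.mpr hune
  -- the test point
  set s : ℝ := Real.sqrt σ * r / ‖u‖ with hs
  have hs0 : 0 < s := by positivity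
  set ζ : X × Y := (z.1, z.2 + s • u) with hζ
  have hdisp : ζ - z = ((0 : X), s • u) := by
    rw [hζ]; ext <;> simp
  have hζM : normM K τ σ (ζ - z) ≤ r := by
    rw [hdisp, normM_inr K τ hσ, norm_smul, Real.norm_of_nonneg hs0.le, hs]
    apply le_of_eq
    field_simp
  have hgap : gap K c b z ζ = Real.sqrt σ * r * ‖u‖ := by
    rw [gap_eq_inner_displacement, hdisp]
    simp only [map_zero, inner_zero_right, inner_zero_left, sub_zero]
    rw [← hu, real_inner_smul_right, real_inner_self_eq_norm_sq, hs]
    field_simp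
  have hζ1 : ζ.1 ∈ C := hz1
  have h := gap_le_mul_rho K C univ c b τ σ (ζ := ζ) hr hbdd hζ1 (mem_univ _) hζM
  rw [hgap] at h
  rw [le_div_iff₀ hsσ]
  nlinarith

/-! ### Lemma 2.1 (2.): the distance of the dual slack to the dual cone -/

/-- **[XiongFreund2024, Lemma 2.1 (2.)], support form**: for `x̄ ∈ C` (`C` a closed convex cone,
`D = univ`, `r > 0`) and every `u ∈ C` with `‖u‖ ≤ 1`, `−⟨c + K*ȳ, u⟩ ≤ ρ_r(z̄)/√τ` — test point
`ζ = (x̄ + √τ r u, ȳ) ∈ C × univ` of `M`-distance `≤ r` and gap `−√τ r ⟨c + K*ȳ, u⟩`.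
[cite: XiongFreund2024, Lemma 2.1 (2.) (proof, display (2.10))] -/
theorem neg_inner_dualSlack_le (K : X →L[ℝ] Y) (C : ProperCone ℝ X) (c : X) (b : Y) {τ σ : ℝ}
    (hτ : 0 < τ) {z : X × Y} (hz1 : z.1 ∈ C) {r : ℝ} (hr : 0 < r)
    (hbdd : BddAbove ((fun ζ => gap K c b z ζ) ''
      {ζ : X × Y | ζ.1 ∈ (C : Set X) ∧ ζ.2 ∈ (univ : Set Y) ∧ normM K τ σ (ζ - z) ≤ r}))
    {u : X} (hu : u ∈ C) (hu1 : ‖u‖ ≤ 1) :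
    -⟪c + K.adjoint z.2, u⟫ ≤ rho K (C : Set X) univ c b τ σ r z / Real.sqrt τ := by
  have hsτ : 0 < Real.sqrt τ := Real.sqrt_pos.mpr hτ
  set s : ℝ := Real.sqrt τ * r with hs
  have hs0 : 0 < s := by positivity
  set ζ : X × Y := (z.1 + s • u, z.2) with hζ
  have hζ1 : ζ.1 ∈ (C : Set X) := by
    show z.1 + s • u ∈ C
    exact C.toPointedCone.add_mem hz1 (C.smul_mem hu hs0.le)
  have hdisp : ζ - z = (s • u, (0 : Y)) := by
    rw [hζ]; ext <;> simp
  have hζM : normM K τ σ (ζ - z) ≤ r := by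
    rw [hdisp, normM_inl K hτ σ, norm_smul, Real.norm_of_nonneg hs0.le, hs, div_le_iff₀ hsτ]
    calc Real.sqrt τ * r * ‖u‖ ≤ Real.sqrt τ * r * 1 := by gcongr
      _ = r * Real.sqrt τ := by ring
  have hgap : gap K c b z ζ = s * (-⟪c + K.adjoint z.2, u⟫) := by
    rw [gap_eq_inner_displacement, hdisp]
    simp only [inner_zero_right, map_smul, real_inner_smul_right, real_inner_smul_left,
      inner_add_left, ContinuousLinearMap.adjoint_inner_left, zero_sub]
    rw [real_inner_comm (K u) z.2]
    ring
  have h := gap_le_mul_rho K (C : Set X) univ c b τ σ hr hbdd hζ1 (mem_univ _) hζM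
  rw [hgap, hs] at h
  rw [le_div_iff₀ hsτ]
  nlinarith

/-- The distance to a closed convex cone's DUAL cone is attained against a unit vector of the cone:
if `C` is a closed convex cone and `−⟨s, u⟩ ≤ a` for all `u ∈ C` with `‖u‖ ≤ 1`, then
`Dist(s, C^*) ≤ a` (nearest point `p` of `C^*`: the variational inequality on the cone `C^*` gives
`⟨s − p, p⟩ = 0` and `p − s ∈ C^{**} = C`). [cite: XiongFreund2024, Lemma 2.1 (2.) (proof: ŝ = P_{K_d}(s̄), −d ∈ K_d^* = K_p, dᵀŝ = 0)] -/
theorem infDist_innerDual_le_of_forall (C : ProperCone ℝ X) (s : X) {a : ℝ}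
    (h : ∀ u ∈ C, ‖u‖ ≤ 1 → -⟪s, u⟫ ≤ a) : infDist s (ProperCone.innerDual (C : Set X) : Set X) ≤ a := by
  set Cd : Set X := (ProperCone.innerDual (C : Set X) : Set X) with hCd
  have hCdne : Cd.Nonempty := (ProperCone.innerDual (C : Set X)).nonempty
  have hCdcl : IsClosed Cd := (ProperCone.innerDual (C : Set X)).isClosed
  have hCdconv : Convex ℝ Cd := (ProperCone.innerDual (C : Set X)).convex
  have ha0 : 0 ≤ a := by
    have := h 0 C.toPointedCone.zero_mem (by simp)
    simpa using this
  -- nearest point `p ∈ C^*`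
  obtain ⟨p, hp, hpmin⟩ := exists_norm_eq_iInf_of_complete_convex hCdne hCdcl.isComplete hCdconv s
  have hvar := (norm_eq_iInf_iff_real_inner_le_zero hCdconv hp).mp hpmin
  set d := s - p with hd
  -- `⟨d, p⟩ = 0` (test `w = 0` and `w = 2p`)
  have hp2 : (2 : ℝ) • p ∈ Cd := (ProperCone.innerDual (C : Set X)).smul_mem hp (by norm_num)
  have h0 : (0 : X) ∈ Cd := (ProperCone.innerDual (C : Set X)).toPointedCone.zero_mem
  have hdp : ⟪d, p⟫ = 0 := by
    have h1 := hvar 0 h0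
    have h2 := hvar _ hp2
    rw [zero_sub, inner_neg_right] at h1
    rw [two_smul, add_sub_cancel_right] at h2
    rw [hd]
    linarith
  -- `−d ∈ C^{**} = C`
  have hnegd : -d ∈ C := by
    have hmem : -d ∈ ProperCone.innerDual (Cd : Set X) := by
      rw [ProperCone.mem_innerDual]
      intro w hw
      have h1 := hvar w hw
      rw [inner_sub_right] at h1
      rw [inner_neg_right, real_inner_comm, hd]
      linarith
    rwa [hCd, ProperCone.innerDual_innerDual] at hmem
  have hinf : infDist s Cd ≤ ‖d‖ := by
    have := infDist_le_dist_of_mem (x := s) hp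
    rwa [dist_eq_norm] at this
  rcases eq_or_ne d 0 with hd0 | hdne
  · rw [hd0, norm_zero] at hinf
    exact hinf.trans ha0
  have hdn : 0 < ‖d‖ := norm_pos_iff.mpr hdne
  -- the unit vector `u = −d/‖d‖ ∈ C` realizes `−⟨s, u⟩ = ‖d‖`
  set u := ‖d‖⁻¹ • (-d) with hu
  have huC : u ∈ C := C.smul_mem hnegd (inv_nonneg.mpr hdn.le)
  have hu1 : ‖u‖ ≤ 1 := by
    rw [hu, norm_smul, norm_inv, norm_norm, norm_neg, inv_mul_cancel₀ hdn.ne']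
  have hsu : -⟪s, u⟫ = ‖d‖ := by
    have hs : s = p + d := by rw [hd]; abel
    rw [hs, hu, real_inner_smul_right, inner_neg_right, inner_add_left, real_inner_comm d p, hdp,
      zero_add, real_inner_self_eq_norm_sq]
    field_simp
  have := h u huC hu1
  rw [hsu] at this
  exact hinf.trans this

/-- **[XiongFreund2024, Lemma 2.1 (2.)]**: for `x̄ ∈ C` (`C` a closed convex cone, `D = univ`, `r > 0`)
the dual slack `s̄ = c + K*ȳ` satisfies `Dist(s̄, C^*) ≤ ρ_r(z̄)/√τ` (`C^* = {s : ⟨x, s⟩ ≥ 0 ∀ x ∈ C}`;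
in print `Dist(w̄, K) = Dist(s̄, K_d)` since `x̄ ∈ K_p`). [cite: XiongFreund2024, Lemma 2.1 (2.)] -/
theorem infDist_dualSlack_innerDual_le (K : X →L[ℝ] Y) (C : ProperCone ℝ X) (c : X) (b : Y)
    {τ σ : ℝ} (hτ : 0 < τ) {z : X × Y} (hz1 : z.1 ∈ C) {r : ℝ} (hr : 0 < r)
    (hbdd : BddAbove ((fun ζ => gap K c b z ζ) ''
      {ζ : X × Y | ζ.1 ∈ (C : Set X) ∧ ζ.2 ∈ (univ : Set Y) ∧ normM K τ σ (ζ - z) ≤ r})) :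
    infDist (c + K.adjoint z.2) (ProperCone.innerDual (C : Set X) : Set X) ≤
      rho K (C : Set X) univ c b τ σ r z / Real.sqrt τ :=
  infDist_innerDual_le_of_forall C _ fun _ hu hu1 =>
    neg_inner_dualSlack_le K C c b hτ hz1 hr hbdd hu hu1

/-! ### Lemma 2.1 (3.): the duality gap -/

/-- **[XiongFreund2024, Lemma 2.1 (3.)]**: for `x̄ ∈ C` (`C` a cone, `D = univ`, `r > 0`) the
primal–dual objective gap satisfies `⟨c, x̄⟩ + ⟨b, ȳ⟩ ≤ max{r, ‖z̄‖_M} · ρ_r(z̄)` — shrink `z̄` towards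
`0` by the factor `1 − θ`, `θ = min{r/‖z̄‖_M, 1}` (the point stays in `C × univ`), whose gap is
`θ(⟨c, x̄⟩ + ⟨b, ȳ⟩)`. (In print `Gap(w̄) = cᵀx̄ − bᵀȳ` with the opposite sign convention for `b`.)
[cite: XiongFreund2024, Lemma 2.1 (3.) (proof, (2.11)–(2.12))] -/
theorem primalDual_gap_le (K : X →L[ℝ] Y) (C : ProperCone ℝ X) (c : X) (b : Y) {τ σ : ℝ}
    {z : X × Y} (hz1 : z.1 ∈ C) {r : ℝ} (hr : 0 < r)
    (hbdd : BddAbove ((fun ζ => gap K c b z ζ) ''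
      {ζ : X × Y | ζ.1 ∈ (C : Set X) ∧ ζ.2 ∈ (univ : Set Y) ∧ normM K τ σ (ζ - z) ≤ r})) :
    ⟪c, z.1⟫ + ⟪b, z.2⟫ ≤ max r (normM K τ σ z) * rho K (C : Set X) univ c b τ σ r z := by
  set G := ⟪c, z.1⟫ + ⟪b, z.2⟫ with hG
  have hρ0 : 0 ≤ rho K (C : Set X) univ c b τ σ r z :=
    rho_nonneg_of_bddAbove K (C : Set X) univ c b τ σ hr hbdd hz1 (mem_univ _)
  have hnz : 0 ≤ normM K τ σ z := normM_nonneg K τ σ z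
  -- the gap along the shrink `ζ = z + (−θ) • z`
  have hgap : ∀ θ : ℝ, gap K c b z (z + (-θ) • z) = θ * G := by
    intro θ
    rw [gap_eq_inner_displacement, add_sub_cancel_left, hG]
    simp only [Prod.smul_snd, Prod.smul_fst, real_inner_smul_right, map_smul, real_inner_smul_left,
      inner_sub_left]
    ring
  have hfeas : ∀ θ : ℝ, θ ≤ 1 → (z + (-θ) • z).1 ∈ (C : Set X) := by
    intro θ hθ1
    have e : (z + (-θ) • z).1 = (1 - θ) • z.1 := by
      simp only [Prod.fst_add, Prod.smul_fst]
      rw [sub_smul, one_smul, neg_smul]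
      abel
    rw [e]
    exact C.smul_mem hz1 (by linarith)
  -- if `G ≤ 0` there is nothing to prove
  rcases le_or_gt G 0 with hG0 | hGpos
  · exact hG0.trans (mul_nonneg (hr.le.trans (le_max_left _ _)) hρ0)
  rcases le_or_gt (normM K τ σ z) r with hsmall | hlarge
  · -- `‖z‖_M ≤ r`: shrink to `0` (`θ = 1`): `G ≤ r ρ`
    rw [max_eq_left hsmall]
    have hM : normM K τ σ (z + (-(1 : ℝ)) • z - z) ≤ r := by
      rw [add_sub_cancel_left, normM_smul]
      simpa using hsmall
    have h := gap_le_mul_rho K (C : Set X) univ c b τ σ hr hbdd (hfeas 1 le_rfl) (mem_univ _) hM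
    rw [hgap, one_mul] at h
    exact h
  · -- `‖z‖_M > r`: shrink by `θ = r/‖z‖_M`: `G ≤ ‖z‖_M ρ`
    rw [max_eq_right hlarge.le]
    have hzpos : 0 < normM K τ σ z := hr.trans hlarge
    set θ := r / normM K τ σ z with hθ
    have hθ0 : 0 < θ := div_pos hr hzpos
    have hθ1 : θ ≤ 1 := (div_le_one hzpos).mpr hlarge.le
    have hM : normM K τ σ (z + (-θ) • z - z) ≤ r := by
      rw [add_sub_cancel_left, normM_smul, abs_neg, abs_of_pos hθ0, hθ, div_mul_cancel₀ r hzpos.ne']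
    have h := gap_le_mul_rho K (C : Set X) univ c b τ σ hr hbdd (hfeas θ hθ1) (mem_univ _) hM
    rw [hgap] at h
    -- `θ G ≤ r ρ` with `θ = r/‖z‖_M` ⇒ `G ≤ ‖z‖_M ρ`
    have e : θ * G = r * (G / normM K τ σ z) := by rw [hθ]; field_simp
    rw [e] at h
    have h' := le_of_mul_le_mul_left h hr
    rwa [div_le_iff₀ hzpos, mul_comm] at h'

/-! ### The solution set of the conic saddle (`D = univ`): the KKT description -/

/-- **Saddle points of the conic saddle are KKT points**: for `C` a closed convex cone and `D = univ`,
`z* = (x*, y*) ∈ Z*` satisfies `Kx* = b` (primal feasibility), `c + K*y* ∈ C^*` (dual feasibility) and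
`⟨c, x*⟩ + ⟨b, y*⟩ = 0` (zero duality gap; complementarity `⟨c + K*y*, x*⟩ = 0`) — the optimal set is
`W* = F ∩ {Gap = 0}`. [cite: XiongFreund2024, §2.1 display (2.4) and the KKT paragraph before (2.2)] -/
theorem kkt_of_mem_saddleSet (K : X →L[ℝ] Y) (C : ProperCone ℝ X) (c : X) (b : Y) {zs : X × Y}
    (hzs : zs ∈ saddleSet K (C : Set X) univ c b) :
    K zs.1 = b ∧ c + K.adjoint zs.2 ∈ ProperCone.innerDual (C : Set X) ∧
      ⟪c + K.adjoint zs.2, zs.1⟫ = 0 ∧ ⟪c, zs.1⟫ + ⟪b, zs.2⟫ = 0 := by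
  rw [mem_saddleSet_iff] at hzs
  obtain ⟨hx, -, hminx, hmaxy⟩ := hzs
  -- primal feasibility from the maximality in `y` over all of `Y`
  have hprim : K zs.1 = b := by
    have key : ∀ y : Y, ⟪K zs.1 - b, y - zs.2⟫ ≤ 0 := by
      intro y
      have h := hmaxy y (mem_univ _)
      unfold conicL at h
      rw [inner_sub_left, inner_sub_right, inner_sub_right]
      linarith
    have h1 := key (zs.2 + (K zs.1 - b))
    rw [add_sub_cancel_left, real_inner_self_eq_norm_sq] at h1
    have : ‖K zs.1 - b‖ ^ 2 = 0 := le_antisymm h1 (sq_nonneg _)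
    rwa [pow_eq_zero_iff two_ne_zero, norm_eq_zero, sub_eq_zero] at this
  -- dual feasibility and complementarity from the minimality in `x` over the cone
  have key : ∀ x ∈ C, ⟪c + K.adjoint zs.2, zs.1⟫ ≤ ⟪c + K.adjoint zs.2, x⟫ := by
    intro x hxC
    have h := hminx x hxC
    unfold conicL at h
    rw [inner_add_left, inner_add_left, ContinuousLinearMap.adjoint_inner_left,
      ContinuousLinearMap.adjoint_inner_left, real_inner_comm (K zs.1) zs.2, real_inner_comm (K x) zs.2]
    linarith
  have hcomp : ⟪c + K.adjoint zs.2, zs.1⟫ = 0 := by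
    have h0 := key 0 C.toPointedCone.zero_mem
    have h2 := key ((2 : ℝ) • zs.1) (C.smul_mem hx (by norm_num))
    rw [inner_zero_right] at h0
    rw [inner_smul_right] at h2
    linarith
  have hdual : c + K.adjoint zs.2 ∈ ProperCone.innerDual (C : Set X) := by
    rw [ProperCone.mem_innerDual]
    intro x hxC
    rw [real_inner_comm]
    linarith [key x hxC, hcomp]
  refine ⟨hprim, hdual, hcomp, ?_⟩
  have h1 : ⟪c + K.adjoint zs.2, zs.1⟫ = ⟪c, zs.1⟫ + ⟪K zs.1, zs.2⟫ := by
    rw [inner_add_left, ContinuousLinearMap.adjoint_inner_left, real_inner_comm (K zs.1) zs.2]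
  rw [hcomp, hprim] at h1
  linarith

/-! ### Lemma 2.3: a consequence of Fejér monotonicity -/

/-- **[XiongFreund2024, Lemma 2.3]** (from [61, Lemma 2.7]): if `z_b` and `z_c` are both no farther (in
`‖·‖_M`) than `z_a` from every point of `Z* ≠ ∅`, then
`max{‖z_b − z_c‖_M, ‖z_b‖_M} ≤ 2 dist_M(z_a, Z*) + ‖z_a‖_M` (triangle inequality through a near-nearest
`z* ∈ Z*`). [cite: XiongFreund2024, Lemma 2.3] -/
theorem normM_le_two_infDistM_add (K : X →L[ℝ] Y) {τ σ : ℝ} (hτ : 0 < τ) (hσ : 0 < σ)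
    (hK : τ * σ * ‖K‖ ^ 2 ≤ 1) {S : Set (X × Y)} (hS : S.Nonempty) {za zb zc : X × Y}
    (hb : ∀ zs ∈ S, normM K τ σ (zb - zs) ≤ normM K τ σ (za - zs))
    (hc : ∀ zs ∈ S, normM K τ σ (zc - zs) ≤ normM K τ σ (za - zs)) :
    max (normM K τ σ (zb - zc)) (normM K τ σ zb) ≤ 2 * infDistM K τ σ za S + normM K τ σ za := by
  -- against every `zs ∈ S`
  have key : ∀ zs ∈ S, max (normM K τ σ (zb - zc)) (normM K τ σ zb) ≤
      2 * normM K τ σ (za - zs) + normM K τ σ za := by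
    intro zs hzs
    have h1 : normM K τ σ (zb - zc) ≤ normM K τ σ (zb - zs) + normM K τ σ (zc - zs) := by
      rw [normM_sub_rev K τ σ zc zs]
      exact normM_sub_le K hτ hσ hK zb zs zc
    have h2 : normM K τ σ zb ≤ normM K τ σ (zb - zs) + normM K τ σ (zs - za) + normM K τ σ za := by
      have e : zb = (zb - zs) + ((zs - za) + za) := by abel
      calc normM K τ σ zb = normM K τ σ ((zb - zs) + ((zs - za) + za)) := by rw [← e]
        _ ≤ normM K τ σ (zb - zs) + normM K τ σ ((zs - za) + za) := normM_add_le K hτ hσ hK _ _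
        _ ≤ normM K τ σ (zb - zs) + (normM K τ σ (zs - za) + normM K τ σ za) :=
            add_le_add le_rfl (normM_add_le K hτ hσ hK _ _)
        _ = _ := by ring
    rw [normM_sub_rev K τ σ zs za] at h2
    have hn : 0 ≤ normM K τ σ za := normM_nonneg K τ σ za
    exact max_le (by linarith [hb zs hzs, hc zs hzs]) (by linarith [hb zs hzs])
  -- pass to the infimum
  have hmax0 : ∀ zs ∈ S, (max (normM K τ σ (zb - zc)) (normM K τ σ zb) - normM K τ σ za) / 2 ≤
      normM K τ σ (za - zs) := fun zs hzs => by linarith [key zs hzs]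
  have h := le_infDistM K τ σ za hS hmax0
  linarith

/-! ### Corollary 2.5: what the averaged PDHG iterate certifies, at the rate `O(1/k)` -/

/-- The normalized duality gap of the averaged PDHG output at its natural radius is `O(1/k)`:
`ρ_{‖z̄ᵏ − z⁰‖_M}(z̄ᵏ) ≤ 4 dist_M(z⁰, Z*)/k` ([XiongFreund2024, Lemma 2.4] with this file's constants:
Property 3 (i) `ρ_r(z̄ᵏ) ≤ 2r/k` and (ii) `r ≤ 2 dist_M(z⁰, Z*)` of `RestartedPDHG.lean`).
[cite: XiongFreund2024, Lemma 2.4] -/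
theorem rho_avgPDHG_le_div [FiniteDimensional ℝ X] [FiniteDimensional ℝ Y] (K : X →L[ℝ] Y)
    {C : Set X} {D : Set Y} (hC : Convex ℝ C) (hD : Convex ℝ D) (c : X) (b : Y) {τ σ : ℝ}
    (hτ : 0 < τ) (hσ : 0 < σ) (hK : τ * σ * ‖K‖ ^ 2 ≤ 1) {jA : X → X} {jB : Y → Y}
    (hjA : IsResolventMap τ (shiftOp c (normalCone C)) jA)
    (hjB : IsResolventMap σ (shiftOp b (normalCone D)) jB) (hZ : (saddleSet K C D c b).Nonempty)
    (z₀ : X × Y) {k : ℕ} (hk : k ≠ 0) :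
    rho K C D c b τ σ (normM K τ σ (avgPDHG K τ σ jA jB k z₀ - z₀)) (avgPDHG K τ σ jA jB k z₀) ≤
      4 * infDistM K τ σ z₀ (saddleSet K C D c b) / k := by
  have hk' : (0 : ℝ) < k := Nat.cast_pos.mpr (Nat.pos_of_ne_zero hk)
  have h1 := rho_avgPDHG_le K hC hD c b hτ hσ hK hjA hjB z₀ hk
  have h2 := normM_avgPDHG_sub_le_infDistM K c b hτ hσ hK hjA hjB hZ z₀ hk
  calc _ ≤ 2 * normM K τ σ (avgPDHG K τ σ jA jB k z₀ - z₀) / k := h1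
    _ ≤ 2 * (2 * infDistM K τ σ z₀ (saddleSet K C D c b)) / k :=
        div_le_div_of_nonneg_right (by linarith) hk'.le
    _ = 4 * infDistM K τ σ z₀ (saddleSet K C D c b) / k := by ring

/-- **[XiongFreund2024, Corollary 2.5 (1.)] for PDHG on a conic program** (`C` a closed convex cone,
`D = univ`, `τσ‖K‖² < 1`): the averaged iterate `z̄ᵏ = (x̄ᵏ, ȳᵏ)` has primal residual
`‖Kx̄ᵏ − b‖ ≤ 4 dist_M(z⁰, Z*)/(√σ k)` (in print `8/(√σ λ_min) · Dist_M/k` for `Dist(w̄ᵏ, V)`).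
[cite: XiongFreund2024, Corollary 2.5 (1.)] -/
theorem norm_primal_residual_avgPDHG_le [FiniteDimensional ℝ X] [FiniteDimensional ℝ Y]
    (K : X →L[ℝ] Y) (C : ProperCone ℝ X) (c : X) (b : Y) {τ σ : ℝ} (hτ : 0 < τ) (hσ : 0 < σ)
    (hK : τ * σ * ‖K‖ ^ 2 < 1) {jA : X → X} {jB : Y → Y}
    (hjA : IsResolventMap τ (shiftOp c (normalCone (C : Set X))) jA)
    (hjB : IsResolventMap σ (shiftOp b (normalCone (univ : Set Y))) jB)
    (hZ : (saddleSet K (C : Set X) univ c b).Nonempty) (z₀ : X × Y) {k : ℕ} (hk : k ≠ 0) :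
    ‖K (avgPDHG K τ σ jA jB k z₀).1 - b‖ ≤
      4 * infDistM K τ σ z₀ (saddleSet K (C : Set X) univ c b) / (Real.sqrt σ * k) := by
  set zb := avgPDHG K τ σ jA jB k z₀ with hzb
  set Zs := saddleSet K (C : Set X) univ c b with hZs
  set r := normM K τ σ (zb - z₀) with hr
  have hsσ : 0 < Real.sqrt σ := Real.sqrt_pos.mpr hσ
  have hk' : (0 : ℝ) < k := Nat.cast_pos.mpr (Nat.pos_of_ne_zero hk)
  have hzb1 : zb.1 ∈ (C : Set X) := avgPDHG_fst_mem K C.convex hjA hjB z₀ hk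
  have hd0 : 0 ≤ infDistM K τ σ z₀ Zs := infDistM_nonneg K τ σ _ _
  rcases (normM_nonneg K τ σ (zb - z₀)).eq_or_lt with hr0 | hrpos
  · -- degenerate radius: `z̄ᵏ ∈ Z*`, so the residual vanishes
    have hmem : zb ∈ Zs :=
      avgPDHG_mem_saddleSet_of_normM_eq_zero K C.convex convex_univ c b hτ hσ hK.le hjA hjB z₀ hk
        hr0.symm
    rw [(kkt_of_mem_saddleSet K C c b hmem).1, sub_self, norm_zero]
    positivity
  have hbdd := bddAbove_gap_ball K (C : Set X) univ c b hτ hσ hK zb r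
  have h1 := norm_primal_residual_le K (C : Set X) c b hσ hzb1 hrpos hbdd
  have h2 := rho_avgPDHG_le_div K C.convex convex_univ c b hτ hσ hK.le hjA hjB hZ z₀ hk
  calc ‖K zb.1 - b‖ ≤ rho K (C : Set X) univ c b τ σ r zb / Real.sqrt σ := h1
    _ ≤ (4 * infDistM K τ σ z₀ Zs / k) / Real.sqrt σ := div_le_div_of_nonneg_right h2 hsσ.le
    _ = 4 * infDistM K τ σ z₀ Zs / (Real.sqrt σ * k) := by
        rw [div_div, mul_comm (k : ℝ)]

/-- **[XiongFreund2024, Corollary 2.5 (2.)] for PDHG on a conic program**: the dual slack of the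
averaged iterate satisfies `Dist(c + K*ȳᵏ, C^*) ≤ 4 dist_M(z⁰, Z*)/(√τ k)` (print: `8/√τ · Dist_M/k`).
[cite: XiongFreund2024, Corollary 2.5 (2.)] -/
theorem infDist_dualSlack_avgPDHG_le [FiniteDimensional ℝ X] [FiniteDimensional ℝ Y]
    (K : X →L[ℝ] Y) (C : ProperCone ℝ X) (c : X) (b : Y) {τ σ : ℝ} (hτ : 0 < τ) (hσ : 0 < σ)
    (hK : τ * σ * ‖K‖ ^ 2 < 1) {jA : X → X} {jB : Y → Y}
    (hjA : IsResolventMap τ (shiftOp c (normalCone (C : Set X))) jA)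
    (hjB : IsResolventMap σ (shiftOp b (normalCone (univ : Set Y))) jB)
    (hZ : (saddleSet K (C : Set X) univ c b).Nonempty) (z₀ : X × Y) {k : ℕ} (hk : k ≠ 0) :
    infDist (c + K.adjoint (avgPDHG K τ σ jA jB k z₀).2) (ProperCone.innerDual (C : Set X) : Set X) ≤
      4 * infDistM K τ σ z₀ (saddleSet K (C : Set X) univ c b) / (Real.sqrt τ * k) := by
  set zb := avgPDHG K τ σ jA jB k z₀ with hzb
  set Zs := saddleSet K (C : Set X) univ c b with hZs
  set r := normM K τ σ (zb - z₀) with hr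
  have hsτ : 0 < Real.sqrt τ := Real.sqrt_pos.mpr hτ
  have hk' : (0 : ℝ) < k := Nat.cast_pos.mpr (Nat.pos_of_ne_zero hk)
  have hzb1 : zb.1 ∈ (C : Set X) := avgPDHG_fst_mem K C.convex hjA hjB z₀ hk
  have hd0 : 0 ≤ infDistM K τ σ z₀ Zs := infDistM_nonneg K τ σ _ _
  rcases (normM_nonneg K τ σ (zb - z₀)).eq_or_lt with hr0 | hrpos
  · have hmem : zb ∈ Zs :=
      avgPDHG_mem_saddleSet_of_normM_eq_zero K C.convex convex_univ c b hτ hσ hK.le hjA hjB z₀ hk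
        hr0.symm
    have hin : c + K.adjoint zb.2 ∈ (ProperCone.innerDual (C : Set X) : Set X) :=
      (kkt_of_mem_saddleSet K C c b hmem).2.1
    rw [infDist_zero_of_mem hin]
    positivity
  have hbdd := bddAbove_gap_ball K (C : Set X) univ c b hτ hσ hK zb r
  have h1 := infDist_dualSlack_innerDual_le K C c b hτ hzb1 hrpos hbdd
  have h2 := rho_avgPDHG_le_div K C.convex convex_univ c b hτ hσ hK.le hjA hjB hZ z₀ hk
  calc _ ≤ rho K (C : Set X) univ c b τ σ r zb / Real.sqrt τ := h1
    _ ≤ (4 * infDistM K τ σ z₀ Zs / k) / Real.sqrt τ := div_le_div_of_nonneg_right h2 hsτ.le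
    _ = 4 * infDistM K τ σ z₀ Zs / (Real.sqrt τ * k) := by
        rw [div_div, mul_comm (k : ℝ)]

/-- **[XiongFreund2024, Corollary 2.5 (3.)] for PDHG on a conic program**: the objective gap of the
averaged iterate satisfies `⟨c, x̄ᵏ⟩ + ⟨b, ȳᵏ⟩ ≤ (2 dist_M(z⁰, Z*) + ‖z⁰‖_M) · 4 dist_M(z⁰, Z*)/k`
(Lemma 2.1 (3.) with `max{r, ‖z̄ᵏ‖_M} ≤ 2 dist_M(z⁰, Z*) + ‖z⁰‖_M` by Lemma 2.3; print:
`(16 Dist_M + 8‖z⁰‖_M) Dist_M/k`). [cite: XiongFreund2024, Corollary 2.5 (3.)] -/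
theorem primalDual_gap_avgPDHG_le [FiniteDimensional ℝ X] [FiniteDimensional ℝ Y]
    (K : X →L[ℝ] Y) (C : ProperCone ℝ X) (c : X) (b : Y) {τ σ : ℝ} (hτ : 0 < τ) (hσ : 0 < σ)
    (hK : τ * σ * ‖K‖ ^ 2 < 1) {jA : X → X} {jB : Y → Y}
    (hjA : IsResolventMap τ (shiftOp c (normalCone (C : Set X))) jA)
    (hjB : IsResolventMap σ (shiftOp b (normalCone (univ : Set Y))) jB)
    (hZ : (saddleSet K (C : Set X) univ c b).Nonempty) (z₀ : X × Y) {k : ℕ} (hk : k ≠ 0) :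
    ⟪c, (avgPDHG K τ σ jA jB k z₀).1⟫ + ⟪b, (avgPDHG K τ σ jA jB k z₀).2⟫ ≤
      (2 * infDistM K τ σ z₀ (saddleSet K (C : Set X) univ c b) + normM K τ σ z₀) *
        (4 * infDistM K τ σ z₀ (saddleSet K (C : Set X) univ c b) / k) := by
  set zb := avgPDHG K τ σ jA jB k z₀ with hzb
  set Zs := saddleSet K (C : Set X) univ c b with hZs
  set r := normM K τ σ (zb - z₀) with hr
  have hk' : (0 : ℝ) < k := Nat.cast_pos.mpr (Nat.pos_of_ne_zero hk)
  have hzb1 : zb.1 ∈ (C : Set X) := avgPDHG_fst_mem K C.convex hjA hjB z₀ hk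
  have hd0 : 0 ≤ infDistM K τ σ z₀ Zs := infDistM_nonneg K τ σ _ _
  have hn0 : 0 ≤ normM K τ σ z₀ := normM_nonneg K τ σ _
  rcases (normM_nonneg K τ σ (zb - z₀)).eq_or_lt with hr0 | hrpos
  · have hmem : zb ∈ Zs :=
      avgPDHG_mem_saddleSet_of_normM_eq_zero K C.convex convex_univ c b hτ hσ hK.le hjA hjB z₀ hk
        hr0.symm
    rw [(kkt_of_mem_saddleSet K C c b hmem).2.2.2]
    positivity
  have hbdd := bddAbove_gap_ball K (C : Set X) univ c b hτ hσ hK zb r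
  have h1 := primalDual_gap_le K C c b hzb1 hrpos hbdd
  have h2 := rho_avgPDHG_le_div K C.convex convex_univ c b hτ hσ hK.le hjA hjB hZ z₀ hk
  have hρ0 : 0 ≤ rho K (C : Set X) univ c b τ σ r zb :=
    rho_nonneg_of_bddAbove K (C : Set X) univ c b τ σ hrpos hbdd hzb1 (mem_univ _)
  -- Lemma 2.3 with `z_a = z_c = z⁰`, `z_b = z̄ᵏ` (Fejér monotonicity of the averaged map)
  have h3 : max r (normM K τ σ zb) ≤ 2 * infDistM K τ σ z₀ Zs + normM K τ σ z₀ := by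
    have h := normM_le_two_infDistM_add K hτ hσ hK.le hZ (za := z₀) (zb := zb) (zc := z₀)
      (fun zs hzs => normM_avgPDHG_sub_saddle_le K hτ hσ hK.le
        (isMonotone_shiftOp c (isMonotone_normalCone (C : Set X)))
        (isMonotone_shiftOp b (isMonotone_normalCone (univ : Set Y))) hjA hjB hzs z₀ hk)
      (fun zs _ => le_rfl)
    exact h
  calc ⟪c, zb.1⟫ + ⟪b, zb.2⟫ ≤ max r (normM K τ σ zb) * rho K (C : Set X) univ c b τ σ r zb := h1
    _ ≤ (2 * infDistM K τ σ z₀ Zs + normM K τ σ z₀) * (4 * infDistM K τ σ z₀ Zs / k) :=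
        mul_le_mul h3 h2 hρ0 (by positivity)

end Literature.Analysis.Convex.ConicNormalizedDualityGap
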